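import Mathlib.LinearAlgebra.Semisimple
import Summits.Langlands.Langlands.Theorems.IrreducibilityBySelfDualityReciprocityUpToIrreducibilityRStringDefs
import HarnessLib

/-!
# Twisted heads of strings are continuous and Frobenius-semisimple (toward stub S-17a-B of line
# `Sketch`, crux stmt-Langlands-17925 `IrreducibilityBySelfDuality.ReciprocityUpToIrreducibilityR`)

Henniart's reconstruction (Bull. SMF 130 (2002), Thm 1.7 (a), §4) probes a Frobenius-semisimple
Weil–Deligne representation `σ = (ρ, N)` with the standard strings `stringModel (twistRep ρ_H a) d` built
on the twisted heads `ρ_H ⊗ ‖·‖^a`, `ρ_H = ρ|_H` the restriction of `ρ` to a `W_F`-stable subspace `H`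
(vocabulary `IsWStable`, `twistRep` in `…RStringDefs`).  For these probes to be Weil–Deligne
representations to which the counting applies, the twisted heads must be

* **continuous** (`WeilGroup.IsContinuousRep`): the open subgroup `U ≤ I_F` on which `ρ` is trivial
  works, since `deg = 0` on inertia kills the twist factor `(q^{deg u})^a`;
* **Frobenius-semisimple**: `ρ(w)|_H` is semisimple as the restriction of the semisimple `ρ(w)` to an
  invariant subspace (Mathlib `Module.End.IsSemisimple.restrict`), and a scalar multiple of a
  semisimple endomorphism is semisimple (Mathlib `Module.End.IsSemisimple_smul`).

Registered sub-goal `stub_head_isContinuous_isSemisimple`; pure linear algebra over `ℂ`; no definitions;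
standard axioms only.
-/

noncomputable section

set_option linter.dupNamespace false

open Module
open Literature.NumberTheory.Automorphic Literature.NumberTheory.GaloisRepresentations
open Literature.NumberTheory.GaloisRepresentations.WeilGroup
open Literature.NumberTheory.GaloisRepresentations.IsNonarchimedeanLocalField

namespace Summit.Langlands.Langlands.Theorems.ReciprocityUpToIrreducibilityR

variable {F : Type} [Field F] [ValuativeRel F] [TopologicalSpace F] [IsNonarchimedeanLocalField F]

section Head

variable {V : Type*} [AddCommGroup V] [Module ℂ V]

/-- The twist, as an endomorphism: `(ρ ⊗ ‖·‖^b)(w) = (q^{deg w})^b • ρ(w)`. [cite: TateCorvallis1979, (4.1.4)] -/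
theorem twistRep_apply_eq_smul (ρ : Representation ℂ (WeilGroup F) V) (b : ℤ) (w : WeilGroup F) :
    twistRep ρ b w = (((residueFieldCard F : ℂ) ^ (deg w)) ^ b) • ρ w :=
  rfl

/-- On inertia the twist is invisible: `(ρ ⊗ ‖·‖^b)(u) = ρ(u)` for `u ∈ I_F` (`deg u = 0`).
[cite: TateCorvallis1979, (4.1.4)] -/
theorem twistRep_apply_of_mem_inertia (ρ : Representation ℂ (WeilGroup F) V) (b : ℤ)
    {u : WeilGroup F} (hu : u ∈ inertia F) : twistRep ρ b u = ρ u := by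
  rw [twistRep_apply_eq_smul, WeilDeligneRep.deg_eq_zero_of_mem_inertia hu, zpow_zero, one_zpow,
    one_smul]

/-- An unramified twist of a continuous representation of `W_F` is continuous (same open subgroup of
inertia). [cite: TateCorvallis1979, (4.1.4)] -/
theorem isContinuousRep_twistRep {ρ : Representation ℂ (WeilGroup F) V}
    (hρ : WeilGroup.IsContinuousRep ρ) (b : ℤ) : WeilGroup.IsContinuousRep (twistRep ρ b) := by
  obtain ⟨U, hU, hUo, hρU⟩ := hρ
  exact ⟨U, hU, hUo, fun u hu => by rw [twistRep_apply_of_mem_inertia ρ b (hU hu), hρU u hu]⟩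

/-- An unramified twist of a representation with semisimple `ρ(w)` has semisimple `(ρ ⊗ ‖·‖^b)(w)`
(a scalar multiple of a semisimple endomorphism is semisimple). [folklore] -/
theorem isSemisimple_twistRep {ρ : Representation ℂ (WeilGroup F) V} {w : WeilGroup F}
    (h : Module.End.IsSemisimple (ρ w)) (b : ℤ) : Module.End.IsSemisimple (twistRep ρ b w) := by
  rw [twistRep_apply_eq_smul]
  exact Module.End.IsSemisimple_smul _ h

/-- The restriction of a continuous representation of `W_F` to a stable subspace is continuous (same
open subgroup of inertia). [cite: TateCorvallis1979, (4.1.2)] -/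
theorem isContinuousRep_subrepresentation {ρ : Representation ℂ (WeilGroup F) V}
    (hρ : WeilGroup.IsContinuousRep ρ) (H : Submodule ℂ V) (hH : ∀ w, H ≤ H.comap (ρ w)) :
    WeilGroup.IsContinuousRep (ρ.subrepresentation H hH) := by
  obtain ⟨U, hU, hUo, hρU⟩ := hρ
  refine ⟨U, hU, hUo, fun u hu => LinearMap.ext fun x => Subtype.ext ?_⟩
  rw [Representation.subrepresentation_apply, LinearMap.coe_restrict_apply, hρU u hu]
  rfl

/-- The restriction of a semisimple `ρ(w)` to a `W_F`-stable subspace is semisimple (Mathlib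
`Module.End.IsSemisimple.restrict`). [folklore] -/
theorem isSemisimple_subrepresentation {ρ : Representation ℂ (WeilGroup F) V} (H : Submodule ℂ V)
    (hH : ∀ w, H ≤ H.comap (ρ w)) {w : WeilGroup F} (h : Module.End.IsSemisimple (ρ w)) :
    Module.End.IsSemisimple (ρ.subrepresentation H hH w) := by
  rw [Representation.subrepresentation_apply]
  exact h.restrict ((Module.End.mem_invtSubmodule _).mpr (hH w))

end Head

/-- **Registered sub-goal `stub_head_isContinuous_isSemisimple`**: for a Frobenius-semisimple
Weil–Deligne representation `σ` and a `W_F`-stable subspace `H`, every unramified twist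
`ρ_H ⊗ ‖·‖^a` of the head representation `ρ_H = σ.ρ|_H` is continuous (the open subgroup of inertia
killing `σ.ρ` works, `deg = 0` on inertia) and has all `(ρ_H ⊗ ‖·‖^a)(w)` semisimple (restriction to
an invariant subspace and non-zero scalar multiples preserve semisimplicity).
[cite: TateCorvallis1979, (4.1.2)–(4.1.4)] -/
theorem stub_head_isContinuous_isSemisimple : ∀ (F : Type) [Field F] [ValuativeRel F] [TopologicalSpace F] [IsNonarchimedeanLocalField F] (V : Type) [AddCommGroup V] [Module ℂ V] [FiniteDimensional ℂ V] (σ : WeilDeligneRep F ℂ V), σ.IsFrobSemisimple → ∀ (H : Submodule ℂ V) (hH : IsWStable σ H) (a : ℤ), WeilGroup.IsContinuousRep (twistRep (σ.ρ.subrepresentation H hH) a) ∧ ∀ w : WeilGroup F, Module.End.IsSemisimple (twistRep (σ.ρ.subrepresentation H hH) a w) :=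
  fun _ _ _ _ _ _ _ _ _ σ hσ H hH a =>
    ⟨isContinuousRep_twistRep (isContinuousRep_subrepresentation σ.isContinuous H hH) a,
      fun w => isSemisimple_twistRep (isSemisimple_subrepresentation H hH (hσ w)) a⟩

end Summit.Langlands.Langlands.Theorems.ReciprocityUpToIrreducibilityR

end
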